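import Literature.Probability.PointProcesses.BandLimitedLatticeMimicry
import HarnessLib

/-!
# The falling-factorial identity for the distinct-tuple weight of a lattice configuration
# (Lagarias–Rodgers 2021, §1.2, display (1.5)) — PROVED

Companion (proof layer, no new definitions, no new facts) of
`Literature/Probability/PointProcesses/BandLimitedLatticeMimicry.lean`. That file encodes a point
configuration on the lattice `aℤ` by site multiplicities `N : ℤ → ℕ` and renders Lagarias–Rodgers'
sum over ordered tuples of DISTINCT indices `Σ^{distinct}_{j_1,…,j_n} η(u_{j_1},…,u_{j_n})` as the
lattice sum weighted by `LagariasRodgers2021.tupleWeight N k`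
(`= ∏_{s ∈ range k} N(s)(N(s)−1)⋯(N(s)−r_s+1)`, `r_s = #{i : k i = s}`). The source's sanity
identity for this sum is [LR21, §1.2 (1.5)]:

> "if `V` is any Borel subset of `ℝ` (or `aℤ`), we have
> `Σ^{distinct}_{j_1,…,j_n} 1_V(u_{j_1}) ⋯ 1_V(u_{j_n}) = ∏_{i=0}^{n−1} (#_V(u) − i)`."

Here we PROVE the encoded form of (1.5): for every finite set of sites `S` and multiplicities `N`,
`∑_{k : Fin n → S} W_N(k) = (∑_{s ∈ S} N s)·(∑_{s ∈ S} N s − 1)⋯(∑_{s ∈ S} N s − n + 1)`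
(`Nat.descFactorial`), i.e. the weighted lattice sum of the indicator of `Sⁿ` counts exactly the
ordered `n`-tuples of distinct particles in `S` — confirming that `tupleWeight` is the right
weight (in particular for `S` = the window sites of `[L, L+1]`, the count is
`#_{[L,L+1]}(#_{[L,L+1]} − 1)⋯`, the quantity whose expectations the u.l.m. condition bounds).

Proof: induction on `n`, splitting `k : Fin (n+1) → S` as `Fin.cons s₀ k'`; adding one index at
the site `s₀` multiplies the weight by `N(s₀) − r_{s₀}(k')` (`Nat.descFactorial_succ`), and
`∑_{s₀ ∈ S} (N(s₀) − r_{s₀}(k')) = ∑ N − n` whenever the weight of `k'` is non-zero (all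
`r_s ≤ N s`), while tuples of weight zero contribute nothing.

§2 (appended): NON-VACUITY of the u.l.m. lattice-process predicate of the companion file — the
window `[L, L+1]` meets at most `⌈1/a⌉ + 1` sites of `aℤ` (`card_windowSites_le`), so the
deterministic configurations "every site of `aℤ` occupied once" and "no points" (on the one-point
probability space) satisfy `IsULMLatticeProcess` (`isULMLatticeProcess_fullLattice`,
`isULMLatticeProcess_empty`).
-/

namespace Literature.Probability.PointProcesses

namespace LagariasRodgers2021

open Finset

/-- The weight as a product over any finite SUPERSET `S` of the sites used by `k`: sites not
visited contribute the empty falling factorial `1`. [cite: LagariasRodgers2021, §1.2 (1.4)–(1.5)] -/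
theorem tupleWeight_eq_prod_superset {n : ℕ} (N : ℤ → ℕ) (k : Fin n → ℤ) {S : Finset ℤ}
    (hS : ∀ i, k i ∈ S) :
    tupleWeight N k = ∏ s ∈ S, (N s).descFactorial (univ.filter fun i ↦ k i = s).card := by
  unfold tupleWeight
  apply Finset.prod_subset
  · intro s hs
    obtain ⟨i, -, rfl⟩ := Finset.mem_image.mp hs
    exact hS i
  · intro s _ hs
    have h0 : (univ.filter fun i ↦ k i = s).card = 0 := by
      rw [Finset.card_eq_zero, Finset.filter_eq_empty_iff]
      intro i _ hi
      exact hs (Finset.mem_image.mpr ⟨i, Finset.mem_univ _, hi⟩)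
    rw [h0, Nat.descFactorial_zero]

/-- If some site is visited more often than its multiplicity allows, the weight vanishes.
[cite: LagariasRodgers2021, §1.2 (1.4)–(1.5)] -/
theorem tupleWeight_eq_zero_of_lt_card {n : ℕ} (N : ℤ → ℕ) (k : Fin n → ℤ) (s : ℤ)
    (h : N s < (univ.filter fun i ↦ k i = s).card) : tupleWeight N k = 0 := by
  have hpos : 0 < (univ.filter fun i ↦ k i = s).card := lt_of_le_of_lt (Nat.zero_le _) h
  obtain ⟨i, hi⟩ := Finset.card_pos.mp hpos
  have hki : k i = s := (Finset.mem_filter.mp hi).2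
  unfold tupleWeight
  apply Finset.prod_eq_zero (Finset.mem_image.mpr ⟨i, Finset.mem_univ _, hki⟩)
  exact Nat.descFactorial_eq_zero_iff_lt.mpr h

/-- Occupation counts of `Fin.cons s₀ k`: the new index sits at `s₀`.
[cite: LagariasRodgers2021, §1.2 (1.4)–(1.5)] -/
theorem card_filter_cons_eq {n : ℕ} (k : Fin n → ℤ) (s₀ s : ℤ) :
    (univ.filter fun i : Fin (n + 1) ↦ (Fin.cons s₀ k : Fin (n + 1) → ℤ) i = s).card =
      (univ.filter fun i ↦ k i = s).card + (if s₀ = s then 1 else 0) := by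
  simp only [Finset.card_filter, Fin.sum_univ_succ, Fin.cons_zero, Fin.cons_succ]
  exact add_comm _ _

/-- Adding one index at the site `s₀` multiplies the weight by the number `N(s₀) − r_{s₀}(k)` of
particles at `s₀` not yet used. [cite: LagariasRodgers2021, §1.2 (1.4)–(1.5)] -/
theorem tupleWeight_cons {n : ℕ} (N : ℤ → ℕ) (k : Fin n → ℤ) (s₀ : ℤ) {S : Finset ℤ}
    (hS : ∀ i, k i ∈ S) (h₀ : s₀ ∈ S) :
    tupleWeight N (Fin.cons s₀ k : Fin (n + 1) → ℤ) =
      tupleWeight N k * (N s₀ - (univ.filter fun i ↦ k i = s₀).card) := by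
  have hS' : ∀ i : Fin (n + 1), (Fin.cons s₀ k : Fin (n + 1) → ℤ) i ∈ S := fun i ↦ by
    refine Fin.cases ?_ (fun j ↦ ?_) i
    · simpa using h₀
    · simpa using hS j
  rw [tupleWeight_eq_prod_superset N _ hS', tupleWeight_eq_prod_superset N k hS]
  have key : ∀ s ∈ S,
      (N s).descFactorial (univ.filter fun i : Fin (n + 1) ↦
          (Fin.cons s₀ k : Fin (n + 1) → ℤ) i = s).card =
        (N s).descFactorial (univ.filter fun i ↦ k i = s).card *
          (if s = s₀ then N s₀ - (univ.filter fun i ↦ k i = s₀).card else 1) := by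
    intro s _
    rw [card_filter_cons_eq]
    by_cases h : s = s₀
    · subst h
      rw [if_pos rfl, if_pos rfl, Nat.descFactorial_succ, mul_comm]
    · rw [if_neg (Ne.symm h), if_neg h, add_zero, mul_one]
  rw [Finset.prod_congr rfl key, Finset.prod_mul_distrib, Finset.prod_ite_eq' S s₀, if_pos h₀]

/-- The occupation counts of a tuple with all sites in `S` add up to its length.
[cite: LagariasRodgers2021, §1.2 (1.4)–(1.5)] -/
theorem sum_card_filter_eq {n : ℕ} (k : Fin n → ℤ) {S : Finset ℤ} (hS : ∀ i, k i ∈ S) :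
    ∑ s ∈ S, (univ.filter fun i ↦ k i = s).card = n := by
  have h := Finset.card_eq_sum_card_fiberwise (s := (univ : Finset (Fin n))) (t := S) (f := k)
    (fun i _ ↦ hS i)
  rw [Finset.card_univ, Fintype.card_fin] at h
  exact h.symm

/-- For a tuple of non-zero weight, `∑_{s ∈ S} (N(s) − r_s(k)) = (∑_{s ∈ S} N(s)) − n`; in general
the identity holds after multiplication by the weight. [cite: LagariasRodgers2021, §1.2 (1.4)–(1.5)] -/
theorem tupleWeight_mul_sum_sub {n : ℕ} (N : ℤ → ℕ) (k : Fin n → ℤ) {S : Finset ℤ}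
    (hS : ∀ i, k i ∈ S) :
    tupleWeight N k * ∑ s ∈ S, (N s - (univ.filter fun i ↦ k i = s).card) =
      tupleWeight N k * ((∑ s ∈ S, N s) - n) := by
  by_cases hle : ∀ s ∈ S, (univ.filter fun i ↦ k i = s).card ≤ N s
  · rw [Finset.sum_tsub_distrib S hle, sum_card_filter_eq k hS]
  · simp only [not_forall, not_le] at hle
    obtain ⟨s, -, hs⟩ := hle
    rw [tupleWeight_eq_zero_of_lt_card N k s hs, zero_mul, zero_mul]

/-- **Lagarias–Rodgers' identity (1.5) in the lattice encoding** (PROVED): for any finite set of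
sites `S` and multiplicities `N`, the weighted number of `S`-valued site tuples is the falling
factorial of the number of particles in `S`:
`∑_{k : Fin n → S} W_N(k) = (∑_{s∈S} N s)(∑_{s∈S} N s − 1)⋯(∑_{s∈S} N s − n + 1)` — i.e.
`Σ^{distinct} ∏_i 1_S(u_{j_i}) = ∏_{i<n} (#_S(u) − i)`. [cite: LagariasRodgers2021, §1.2 (1.5)] -/
theorem sum_tupleWeight_eq_descFactorial (N : ℤ → ℕ) (S : Finset ℤ) (n : ℕ) :
    ∑ k : Fin n → S, tupleWeight N (fun i ↦ (k i : ℤ)) = (∑ s ∈ S, N s).descFactorial n := by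
  induction n with
  | zero =>
    rw [Fintype.sum_unique, Nat.descFactorial_zero]
    simp [tupleWeight]
  | succ n ih =>
    rw [← (Fin.consEquiv fun _ : Fin (n + 1) ↦ ↥S).sum_comp, Fintype.sum_prod_type_right]
    have hcons : ∀ (a : S) (g : Fin n → S),
        (fun i ↦ (((Fin.consEquiv fun _ : Fin (n + 1) ↦ ↥S) (a, g)) i : ℤ)) =
          (Fin.cons (a : ℤ) (fun i ↦ (g i : ℤ)) : Fin (n + 1) → ℤ) := by
      intro a g
      funext i
      refine Fin.cases ?_ (fun j ↦ ?_) i <;> simp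
    have hstep : ∀ g : Fin n → S,
        ∑ a : S, tupleWeight N (fun i ↦ (((Fin.consEquiv fun _ : Fin (n + 1) ↦ ↥S) (a, g)) i : ℤ)) =
          tupleWeight N (fun i ↦ (g i : ℤ)) * ((∑ s ∈ S, N s) - n) := by
      intro g
      have hg : ∀ i, ((g i : ℤ)) ∈ S := fun i ↦ (g i).2
      have h1 : ∑ a : S, tupleWeight N
            (fun i ↦ (((Fin.consEquiv fun _ : Fin (n + 1) ↦ ↥S) (a, g)) i : ℤ)) =
          ∑ a : S, tupleWeight N (fun i ↦ (g i : ℤ)) *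
            (N a - (univ.filter fun i ↦ (g i : ℤ) = a).card) :=
        Finset.sum_congr rfl fun a _ ↦ by rw [hcons a g, tupleWeight_cons N _ _ hg a.2]
      rw [h1, ← Finset.mul_sum,
        Finset.sum_coe_sort S (fun s ↦ N s - (univ.filter fun i ↦ (g i : ℤ) = s).card)]
      exact tupleWeight_mul_sum_sub N _ hg
    rw [Finset.sum_congr rfl fun g _ ↦ hstep g, ← Finset.sum_mul, ih, Nat.descFactorial_succ,
      mul_comm]

/-- In particular for the window `[L, L+1]`: the weighted number of tuples of window sites is the
falling factorial `#_{[L,L+1]}(u)·(#_{[L,L+1]}(u) − 1)⋯(#_{[L,L+1]}(u) − n + 1)` of the window count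
(`windowCount`) — the random variable whose moments the u.l.m. condition controls.
[cite: LagariasRodgers2021, §1.2 (1.5)–(1.6)] -/
theorem sum_tupleWeight_windowSites (N : ℤ → ℕ) (a L : ℝ) (n : ℕ) :
    ∑ k : Fin n → windowSites a L, tupleWeight N (fun i ↦ (k i : ℤ)) =
      (windowCount a N L).descFactorial n :=
  sum_tupleWeight_eq_descFactorial N (windowSites a L) n

/-! ## §2. Non-vacuity of `IsULMLatticeProcess` -/

/-- The window `[L, L+1]` of LR's u.l.m. condition contains at most `⌈1/a⌉ + 1` sites of the
lattice `aℤ` (`a > 0`) (API for the printed definition). [cite: LagariasRodgers2021, §1.2 (u.l.m. condition)] -/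
theorem card_windowSites_le {a : ℝ} (ha : 0 < a) (L : ℝ) :
    (windowSites a L).card ≤ ⌈1 / a⌉₊ + 1 := by
  unfold windowSites
  rw [Int.card_Icc]
  have hle : (⌊(L + 1) / a⌋ : ℝ) ≤ (⌈L / a⌉ : ℝ) + (⌈1 / a⌉₊ : ℝ) :=
    calc (⌊(L + 1) / a⌋ : ℝ) ≤ (L + 1) / a := Int.floor_le _
      _ = L / a + 1 / a := by rw [add_div]
      _ ≤ ⌈L / a⌉ + ⌈1 / a⌉₊ := add_le_add (Int.le_ceil _) (Nat.le_ceil _)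
  have h1 : (⌊(L + 1) / a⌋ : ℤ) ≤ ⌈L / a⌉ + (⌈1 / a⌉₊ : ℤ) := by exact_mod_cast hle
  have _ := ha
  omega

/-- For the configuration with every site of `aℤ` occupied exactly once, the window count
`#_{[L,L+1]}` is the number of window sites (API for the printed definition).
[cite: LagariasRodgers2021, §1.2 (u.l.m. condition)] -/
theorem windowCount_one (a L : ℝ) : windowCount a (fun _ ↦ 1) L = (windowSites a L).card := by
  simp [windowCount]

/-- **Non-vacuity witness for the printed u.l.m. condition**: the deterministic process "every
site of `aℤ` occupied once" (one-point probability space) is a u.l.m. lattice process — its `n`-th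
window moments are bounded by `(⌈1/a⌉ + 1)ⁿ` (cf. LR21 §1.5: the lattice-supported processes they
construct are u.l.m. "from this fact and (1.5)"). [cite: LagariasRodgers2021, §1.2 (u.l.m. condition)] -/
theorem isULMLatticeProcess_fullLattice {a : ℝ} (ha : 0 < a) :
    IsULMLatticeProcess (_root_.MeasureTheory.Measure.dirac ()) a (fun _ _ ↦ 1) := by
  refine ⟨inferInstance, fun _ ↦ measurable_const, fun n ↦ ⟨((⌈1 / a⌉₊ + 1 : ℕ) : NNReal) ^ n, ?_⟩⟩
  intro L
  rw [_root_.MeasureTheory.lintegral_dirac]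
  have hc : windowCount a (fun _ ↦ 1) L ≤ ⌈1 / a⌉₊ + 1 := by
    rw [windowCount_one]
    exact card_windowSites_le ha L
  have hc' : (windowCount a (fun _ ↦ 1) L : ENNReal) ≤ ((⌈1 / a⌉₊ + 1 : ℕ) : ENNReal) := by
    exact_mod_cast hc
  calc (windowCount a (fun _ ↦ 1) L : ENNReal) ^ n ≤ ((⌈1 / a⌉₊ + 1 : ℕ) : ENNReal) ^ n :=
        pow_le_pow_left' hc' n
    _ = ((((⌈1 / a⌉₊ + 1 : ℕ) : NNReal) ^ n : NNReal) : ENNReal) := by push_cast; rfl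

/-- **Non-vacuity witness (trivial case)**: the empty configuration is a u.l.m. lattice process
(all window moments are `0ⁿ ≤ 1`). [cite: LagariasRodgers2021, §1.2 (u.l.m. condition)] -/
theorem isULMLatticeProcess_empty (a : ℝ) :
    IsULMLatticeProcess (_root_.MeasureTheory.Measure.dirac ()) a (fun _ _ ↦ 0) := by
  refine ⟨inferInstance, fun _ ↦ measurable_const, fun n ↦ ⟨1, ?_⟩⟩
  intro L
  rw [_root_.MeasureTheory.lintegral_dirac, windowCount_zero]
  push_cast
  exact pow_le_one₀ le_rfl zero_le_one

end LagariasRodgers2021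

end Literature.Probability.PointProcesses
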